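import Mathlib
import HarnessLib
import Summits.AtomisticToContinuum.FouriersLaw.Theses.JunctionLocality
import Summits.AtomisticToContinuum.FouriersLaw.Theorems.JunctionLocalityConductanceLowerBoundStubFisherSquare

/-!
# Forward fields carry the extensive energy mode: `‖g_L‖² ≥ L·T²/(8γ²)` (crux stmt-AtomisticToContinuum-11749, line ForecastSensitivitySketch)

Helper file (`--supports stmt-AtomisticToContinuum-11749`, lead c3).  Fix `pinnedChain ω₂ lam β γ` (all `> 0`), `T > 0`, `L ≥ 1`,
`μ_T = gibbsMeasure L T`, and a classical mean-zero `C² ∩ L²(μ_T)` left forward field `g` (`L_{T,T} g = −(p_0² − T)`); `R` = site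
reflection, `k_j = p_j² − T`.

* `forwardField_add_comp_siteReflection` — ENERGY CONSERVATION in field form, exported: `γ(g + g∘R) = H − ⟨H⟩` pointwise
  (`L_{T,T} H = −γ(k_0 + k_{L−1})` + the `L²(μ_T)`-Liouville theorem; it was so far only an internal step of `stub_fisherSquare`).
* `integral_hamiltonian_mul_kin` — `⟨H, k_j⟩ = T²`;  `integral_kin_mul_kin` — `⟨k_i, k_j⟩ = 2T²·[i = j]` (Maxwellian momenta).
* `integral_forwardField_mul_kin_add_rev` — ROW SUMS at every site: `⟨g, k_j⟩ + ⟨g, k_{L−1−j}⟩ = T²/γ` (the landed `stub_rowSum`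
  is the case `j = 0`): the energy a left-contact fluctuation deposits, time-integrated, at site `j` plus at its mirror site is
  site-independent ("all injected energy exits", `π^L + π^R = 1`, in the exit-fraction reading).
* `integral_forwardField_mul_sum_kin` — the SUM RULE `⟨g, Σ_j k_j⟩ = L·T²/(2γ)`.
* `forwardField_sq_norm_ge` (registered helper) — hence `∫ g² dμ_T ≥ L·T²/(8γ²)`: the forward fields DIVERGE in `L²(μ_T)` like
  `√L` (they contain the energy mode `(H − ⟨H⟩)/(2γ)`), so no `L²`-compactness-in-`L` argument can act on `g_L` itself; the
  `N`-uniform content of the crux (the floor `(L−1)‖∂_{p_{L−1}} g_L‖² ≥ c`) lives in the reflection-odd part (file `…OddFieldFrame`).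

No definitions, no named facts, no sorry.
-/

noncomputable section

open MeasureTheory Filter Topology
open scoped ContDiff
open Literature.MathematicalPhysics.KineticTheory.HeatConduction
open Summit.AtomisticToContinuum.FouriersLaw.Theorems.SuperadditiveResistance.DeviceLiouville
  (kin kin_eq_sq continuous_kin liouvilleOp bathOp generator_eq_liouvilleOp_add eq_zero_of_liouville_pinnedChain)
open Summit.AtomisticToContinuum.FouriersLaw.Cruxes.SuperadditiveResistance.FloatingProbeBypassLaplacian
  (pinnedChain_memLp_two_snd pinnedChain_memLp_two_snd_sq integral_mul_sq_sub_gibbsMeasure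
    integral_mul_sq_sub_gibbsMeasure_eq_zero generator_sub_const liouvilleOp_add' liouvilleOp_const_mul bathOp_add'
    bathOp_const_mul)
open Summit.AtomisticToContinuum.FouriersLaw.Cruxes.SuperadditiveResistance.InsertionToolbox
  (pinnedChain_memLp_two_of_abs_le)

namespace Summit.AtomisticToContinuum.FouriersLaw.Cruxes.ConductanceLowerBound.ForecastSensitivity

variable {ω₂ lam β γ T : ℝ}

/-! ## §1 Energy conservation in field form -/

/-- **`γ(g + g∘R) = H − ⟨H⟩`** pointwise, for every classical mean-zero `C² ∩ L²(μ_T)` left forward field `g` of the `L`-chain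
(`L ≥ 1`): the reflected field is the right bath's forward field, `L_{T,T} H = −γ(k_0 + k_{L−1})`, and a mean-zero `C² ∩ L²`
solution of `L_{T,T} u = 0` vanishes. [folklore] -/
theorem forwardField_add_comp_siteReflection (hω : 0 < ω₂) (hl : 0 < lam) (hβ : 0 < β) (hγ : 0 < γ) (hT : 0 < T)
    {L : ℕ} (hL : 0 < L) {g : PhaseSpace L → ℝ} (hgC : ContDiff ℝ 2 g)
    (hgL2 : MemLp g 2 ((pinnedChain ω₂ lam β γ).gibbsMeasure L T))
    (hg0 : ∫ x, g x ∂((pinnedChain ω₂ lam β γ).gibbsMeasure L T) = 0)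
    (hgeq : ∀ x, (pinnedChain ω₂ lam β γ).generator L T T g x = -(kin L 0 x - T)) :
    ∀ x, γ * (g x + g (siteReflection L x)) =
      (pinnedChain ω₂ lam β γ).hamiltonian L x -
        ∫ y, (pinnedChain ω₂ lam β γ).hamiltonian L y ∂((pinnedChain ω₂ lam β γ).gibbsMeasure L T) := by
  set P := pinnedChain ω₂ lam β γ with hP
  set μ := P.gibbsMeasure L T with hμ
  set H := P.hamiltonian L with hH
  set Bw := OscillatorChain.bathWeight L with hBw
  set i0 : Fin L := ⟨0, hL⟩ with hi0
  haveI : IsProbabilityMeasure μ := pinnedChain_isProbabilityMeasure_gibbsMeasure hω hl.le hβ.le γ L hT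
  have hPγ : P.γ = γ := rfl
  have hV : ∀ r, P.V (-r) = P.V r := pinnedChain_V_neg ω₂ lam β γ
  have hR : MeasurePreserving (siteReflectionEquiv L) μ μ := measurePreserving_siteReflection_gibbsMeasure P hV L T
  have hBnn : ∀ i, 0 ≤ Bw i := bathWeight_nonneg L
  have hBi0 : 0 < Bw i0 := by
    simp only [hBw, OscillatorChain.bathWeight, hi0, if_true]
    split_ifs <;> norm_num
  have hHs : ContDiff ℝ ∞ H :=
    P.contDiff_hamiltonian (pinnedChain_contDiff_U ω₂ lam β γ) (pinnedChain_contDiff_V ω₂ lam β γ) L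
  have hH2 : ContDiff ℝ 2 H := hHs.of_le (by norm_cast)
  have hH0 : ∀ x, 0 ≤ H x := fun x => pinnedChain_hamiltonian_nonneg hω.le hl.le hβ.le γ L x
  have hHL2 : MemLp H 2 μ :=
    pinnedChain_memLp_two_of_abs_le hω hl.le hβ.le γ L hT hHs.continuous (C := 1) (k := 1) fun x => by
      rw [abs_of_nonneg (hH0 x), pow_one, one_mul]
      linarith [hH0 x]
  set gR : PhaseSpace L → ℝ := g ∘ siteReflection L with hgR
  have hgRC : ContDiff ℝ 2 gR := hgC.comp contDiff_siteReflection
  have hgRL2 : MemLp gR 2 μ := hgL2.comp_measurePreserving hR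
  have hgR0 : ∫ x, gR x ∂μ = 0 := by
    have h := hR.integral_comp' (f := siteReflectionEquiv L) g
    simp only [siteReflectionEquiv_apply] at h
    rw [hg0] at h
    simpa only [hgR, Function.comp_apply] using h
  have hgReq : ∀ x, P.generator L T T gR x = -(kin L (L - 1) x - T) := by
    intro x
    rw [hgR, P.generator_comp_siteReflection hV L T T g x, hgeq, kin_zero_siteReflection hL]
  set cH : ℝ := ∫ x, H x ∂μ with hcH
  have hC1 : ContDiff ℝ 2 (fun y => γ * (g + gR) y) := contDiff_const.mul (hgC.add hgRC)
  have hC2 : ContDiff ℝ 2 (fun y => (-1 : ℝ) * (H y - cH)) := contDiff_const.mul (hH2.sub contDiff_const)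
  set u : PhaseSpace L → ℝ := (fun y => γ * (g + gR) y) + fun y => (-1 : ℝ) * (H y - cH) with hu
  have huC : ContDiff ℝ 2 u := hC1.add hC2
  have huL2 : MemLp u 2 μ := ((hgL2.add hgRL2).const_mul γ).add ((hHL2.sub (memLp_const cH)).const_mul (-1))
  have gen_add : ∀ {f₁ f₂ : PhaseSpace L → ℝ}, ContDiff ℝ 2 f₁ → ContDiff ℝ 2 f₂ → ∀ x,
      P.generator L T T (f₁ + f₂) x = P.generator L T T f₁ x + P.generator L T T f₂ x := by
    intro f₁ f₂ h₁ h₂ x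
    rw [generator_eq_liouvilleOp_add, generator_eq_liouvilleOp_add, generator_eq_liouvilleOp_add,
      liouvilleOp_add' P (h₁.differentiable two_ne_zero) (h₂.differentiable two_ne_zero), bathOp_add' h₁ h₂]
    ring
  have gen_const_mul : ∀ (a : ℝ) (f₁ : PhaseSpace L → ℝ) (x : PhaseSpace L),
      P.generator L T T (fun y => a * f₁ y) x = a * P.generator L T T f₁ x := by
    intro a f₁ x
    rw [generator_eq_liouvilleOp_add, generator_eq_liouvilleOp_add, liouvilleOp_const_mul, bathOp_const_mul]
    ring
  have hu_gen : ∀ x, P.generator L T T u x = 0 := by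
    intro x
    have e1 : P.generator L T T u x = P.generator L T T (fun y => γ * (g + gR) y) x +
        P.generator L T T (fun y => (-1 : ℝ) * (H y - cH)) x := gen_add hC1 hC2 x
    have e2 : P.generator L T T (fun y => γ * (g + gR) y) x = γ * P.generator L T T (g + gR) x :=
      gen_const_mul γ (g + gR) x
    have e3 : P.generator L T T (g + gR) x = P.generator L T T g x + P.generator L T T gR x := gen_add hgC hgRC x
    have e4 : P.generator L T T (fun y => (-1 : ℝ) * (H y - cH)) x =
        (-1 : ℝ) * P.generator L T T (fun y => H y - cH) x := gen_const_mul (-1) _ x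
    have e5 : P.generator L T T (fun y => H y - cH) x = P.generator L T T H x := generator_sub_const P T T H cH x
    have e6 : P.generator L T T H x = -(γ * ((kin L 0 x - T) + (kin L (L - 1) x - T))) := by
      rw [generator_eq_liouvilleOp_add, liouvilleOp_hamiltonian, bathOp_bathWeight_hamiltonian P hL, hPγ]
      ring
    rw [e1, e2, e3, e4, e5, e6, hgeq x, hgReq x]
    ring
  have hu_pde : ∀ x, 1 * liouvilleOp P L u x + γ * bathOp L Bw T u x = 0 := fun x => by
    rw [one_mul, ← hu_gen x, generator_eq_liouvilleOp_add]; rfl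
  have hgi : Integrable g μ := hgL2.integrable one_le_two
  have hgRi : Integrable gR μ := hgRL2.integrable one_le_two
  have hHi : Integrable H μ := hHL2.integrable one_le_two
  have hu_mean : ∫ x, u x ∂μ = 0 := by
    have i1 : Integrable (fun y => γ * (g y + gR y)) μ := (hgi.add hgRi).const_mul γ
    have i2 : Integrable (fun y => (-1 : ℝ) * (H y - cH)) μ := (hHi.sub (integrable_const cH)).const_mul (-1)
    simp only [hu, Pi.add_apply]
    rw [integral_add i1 i2, integral_const_mul, integral_const_mul, integral_add hgi hgRi,
      integral_sub hHi (integrable_const cH), integral_const, hg0, hgR0]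
    simp [hcH]
  have hu0 : ∀ x, u x = 0 := fun x =>
    eq_zero_of_liouville_pinnedChain hω hl.le hβ.le γ hL hT Bw hBnn hBi0 one_ne_zero hγ huC huL2 hu_pde hu_mean x
  intro x
  have := hu0 x
  simp only [hu, Pi.add_apply, hgR, Function.comp_apply] at this
  linarith

/-! ## §2 Maxwellian moments -/

/-- `∫ p_j² dμ_T = T` (`μ_T` a probability measure with Maxwellian momenta). [folklore] -/
theorem integral_snd_sq (hω : 0 < ω₂) (hl : 0 ≤ lam) (hβ : 0 ≤ β) (γ : ℝ) (L : ℕ) (hT : 0 < T) (j : Fin L) :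
    ∫ x, x.2 j ^ 2 ∂((pinnedChain ω₂ lam β γ).gibbsMeasure L T) = T := by
  set μ := (pinnedChain ω₂ lam β γ).gibbsMeasure L T with hμ
  haveI : IsProbabilityMeasure μ := pinnedChain_isProbabilityMeasure_gibbsMeasure hω hl hβ γ L hT
  have h0 : ∫ x, (fun _ : PhaseSpace L => (1 : ℝ)) x * (x.2 j ^ 2 - T) ∂μ = 0 :=
    integral_mul_sq_sub_gibbsMeasure_eq_zero hω hl hβ γ L hT j (F := fun _ => (1 : ℝ)) (fun _ _ => rfl) (memLp_const 1)
  have hint : Integrable (fun x : PhaseSpace L => x.2 j ^ 2) μ :=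
    (pinnedChain_memLp_two_snd_sq hω hl hβ γ L hT j).integrable one_le_two
  have h1 : ∫ x, (x.2 j ^ 2 - T) ∂μ = 0 := by
    rw [← h0]
    exact integral_congr_ae (ae_of_all _ fun x => by simp only [one_mul])
  rw [integral_sub hint (integrable_const T), integral_const, smul_eq_mul] at h1
  have hμ1 : μ.real Set.univ = 1 := by simp [Measure.real]
  rw [hμ1, one_mul] at h1
  linarith

/-- `∂_{p_j}(p_j²) = 2 p_j`. [folklore] -/
theorem partialP_snd_sq {L : ℕ} (j : Fin L) (x : PhaseSpace L) :
    partialP j (fun y : PhaseSpace L => y.2 j ^ 2) x = 2 * x.2 j := by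
  unfold partialP
  have h : (fun t : ℝ => (Function.update x.2 j t) j ^ 2) = fun t => t ^ 2 := by
    funext t; simp
  rw [h]
  have hd : HasDerivAt (fun t : ℝ => t ^ 2) (2 * x.2 j) (x.2 j) := by
    simpa using hasDerivAt_pow 2 (x.2 j)
  exact hd.deriv

/-- **`⟨k_i, k_j⟩ = 2T²·[i = j]`** under `μ_T` (`k_j = p_j² − T`; independent Maxwellian momenta). [folklore] -/
theorem integral_kin_mul_kin (hω : 0 < ω₂) (hl : 0 ≤ lam) (hβ : 0 ≤ β) (γ : ℝ) (L : ℕ) (hT : 0 < T) (i j : Fin L) :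
    ∫ x, (x.2 i ^ 2 - T) * (x.2 j ^ 2 - T) ∂((pinnedChain ω₂ lam β γ).gibbsMeasure L T) = if i = j then 2 * T ^ 2 else 0 := by
  set μ := (pinnedChain ω₂ lam β γ).gibbsMeasure L T with hμ
  haveI : IsProbabilityMeasure μ := pinnedChain_isProbabilityMeasure_gibbsMeasure hω hl hβ γ L hT
  have hki2 : MemLp (fun x : PhaseSpace L => x.2 i ^ 2 - T) 2 μ :=
    (pinnedChain_memLp_two_snd_sq hω hl hβ γ L hT i).sub (memLp_const T)
  split_ifs with hij
  · subst hij
    -- `∫ k_i k_i = ∫ p_i² k_i − T ∫ k_i = T ∫ (2 p_i) p_i − 0 = 2T²`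
    have h1 : ∫ x, (fun y : PhaseSpace L => y.2 i ^ 2) x * (x.2 i ^ 2 - T) ∂μ =
        T * ∫ x, partialP i (fun y : PhaseSpace L => y.2 i ^ 2) x * x.2 i ∂μ :=
      integral_mul_sq_sub_gibbsMeasure hω hl hβ γ L hT i (g := fun y : PhaseSpace L => y.2 i ^ 2) (by fun_prop)
        (pinnedChain_memLp_two_snd_sq hω hl hβ γ L hT i)
        (((pinnedChain_memLp_two_snd hω hl hβ γ L hT i).const_mul 2).ae_eq
          (ae_of_all _ fun x => by simp only [partialP_snd_sq]))
    have h2 : ∫ x, partialP i (fun y : PhaseSpace L => y.2 i ^ 2) x * x.2 i ∂μ = 2 * T := by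
      have : (fun x => partialP i (fun y : PhaseSpace L => y.2 i ^ 2) x * x.2 i) = fun x => 2 * x.2 i ^ 2 := by
        funext x; rw [partialP_snd_sq]; ring
      rw [this, integral_const_mul, integral_snd_sq hω hl hβ γ L hT i]
    have h0 : ∫ x, (fun _ : PhaseSpace L => (1 : ℝ)) x * (x.2 i ^ 2 - T) ∂μ = 0 :=
      integral_mul_sq_sub_gibbsMeasure_eq_zero hω hl hβ γ L hT i (F := fun _ => (1 : ℝ)) (fun _ _ => rfl) (memLp_const 1)
    have hint1 : Integrable (fun x : PhaseSpace L => x.2 i ^ 2 * (x.2 i ^ 2 - T)) μ :=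
      (pinnedChain_memLp_two_snd_sq hω hl hβ γ L hT i).integrable_mul hki2
    have hint2 : Integrable (fun x : PhaseSpace L => (x.2 i ^ 2 - T)) μ := hki2.integrable one_le_two
    have key : ∫ x, (x.2 i ^ 2 - T) * (x.2 i ^ 2 - T) ∂μ =
        (∫ x, x.2 i ^ 2 * (x.2 i ^ 2 - T) ∂μ) - T * ∫ x, (x.2 i ^ 2 - T) ∂μ := by
      rw [← integral_const_mul, ← integral_sub hint1 (hint2.const_mul T)]
      exact integral_congr_ae (ae_of_all _ fun x => by ring)
    have h0' : ∫ x, (x.2 i ^ 2 - T) ∂μ = 0 := by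
      rw [← h0]; exact integral_congr_ae (ae_of_all _ fun x => by simp only [one_mul])
    rw [key, h0', mul_zero, sub_zero]
    have h1' : ∫ x, x.2 i ^ 2 * (x.2 i ^ 2 - T) ∂μ = T * (2 * T) := by rw [← h2, ← h1]
    rw [h1']; ring
  · -- `k_i` does not depend on `p_j`
    have hF : ∀ (x : PhaseSpace L) (t : ℝ), (fun y : PhaseSpace L => y.2 i ^ 2 - T)
        (x + t • ((0, Pi.single j 1) : PhaseSpace L)) = (fun y : PhaseSpace L => y.2 i ^ 2 - T) x := by
      intro x t
      simp only [Prod.snd_add, Prod.smul_snd, Pi.add_apply, Pi.smul_apply, Pi.single_apply, if_neg hij, smul_eq_mul,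
        mul_zero, add_zero]
    exact integral_mul_sq_sub_gibbsMeasure_eq_zero hω hl hβ γ L hT j hF hki2

/-- **`⟨H, k_j⟩ = T²`** under `μ_T`: `⟨H, p_j² − T⟩ = T⟨∂_{p_j}H, p_j⟩ = T⟨p_j, p_j⟩`. [folklore] -/
theorem integral_hamiltonian_mul_kin (hω : 0 < ω₂) (hl : 0 ≤ lam) (hβ : 0 ≤ β) (γ : ℝ) (L : ℕ) (hT : 0 < T)
    (j : Fin L) :
    ∫ x, (pinnedChain ω₂ lam β γ).hamiltonian L x * (x.2 j ^ 2 - T) ∂((pinnedChain ω₂ lam β γ).gibbsMeasure L T) = T ^ 2 := by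
  set P := pinnedChain ω₂ lam β γ with hP
  set μ := P.gibbsMeasure L T with hμ
  have hHs : ContDiff ℝ ∞ (P.hamiltonian L) :=
    P.contDiff_hamiltonian (pinnedChain_contDiff_U ω₂ lam β γ) (pinnedChain_contDiff_V ω₂ lam β γ) L
  have hHd : Differentiable ℝ (P.hamiltonian L) := hHs.differentiable (by simp)
  have hH0 : ∀ x, 0 ≤ P.hamiltonian L x := fun x => pinnedChain_hamiltonian_nonneg hω.le hl hβ γ L x
  have hHL2 : MemLp (P.hamiltonian L) 2 μ :=
    pinnedChain_memLp_two_of_abs_le hω hl hβ γ L hT hHs.continuous (C := 1) (k := 1) fun x => by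
      rw [abs_of_nonneg (hH0 x), pow_one, one_mul]
      linarith [hH0 x]
  have hdH : MemLp (partialP j (P.hamiltonian L)) 2 μ :=
    (pinnedChain_memLp_two_snd hω hl hβ γ L hT j).ae_eq (ae_of_all _ fun x => (P.partialP_hamiltonian L x j).symm)
  rw [integral_mul_sq_sub_gibbsMeasure hω hl hβ γ L hT j hHd hHL2 hdH]
  have : (fun x => partialP j (P.hamiltonian L) x * x.2 j) = fun x : PhaseSpace L => x.2 j ^ 2 := by
    funext x; rw [P.partialP_hamiltonian]; ring
  rw [this, integral_snd_sq hω hl hβ γ L hT j]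
  ring

/-! ## §3 Row sums at every site and the sum rule -/

/-- **ROW SUM AT EVERY SITE: `⟨g, k_j⟩ + ⟨g, k_{L−1−j}⟩ = T²/γ`** for every classical mean-zero `C² ∩ L²(μ_T)` left forward field
`g` of the `L`-chain (`L ≥ 1`) and every site `j` (the landed `stub_rowSum` is `j = 0`). [folklore] -/
theorem integral_forwardField_mul_kin_add_rev (hω : 0 < ω₂) (hl : 0 < lam) (hβ : 0 < β) (hγ : 0 < γ) (hT : 0 < T)
    {L : ℕ} (hL : 0 < L) {g : PhaseSpace L → ℝ} (hgC : ContDiff ℝ 2 g)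
    (hgL2 : MemLp g 2 ((pinnedChain ω₂ lam β γ).gibbsMeasure L T))
    (hg0 : ∫ x, g x ∂((pinnedChain ω₂ lam β γ).gibbsMeasure L T) = 0)
    (hgeq : ∀ x, (pinnedChain ω₂ lam β γ).generator L T T g x = -(kin L 0 x - T)) (j : Fin L) :
    (∫ x, g x * (x.2 j ^ 2 - T) ∂((pinnedChain ω₂ lam β γ).gibbsMeasure L T)) +
      ∫ x, g x * (x.2 (Fin.rev j) ^ 2 - T) ∂((pinnedChain ω₂ lam β γ).gibbsMeasure L T) = T ^ 2 / γ := by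
  set P := pinnedChain ω₂ lam β γ with hP
  set μ := P.gibbsMeasure L T with hμ
  haveI : IsProbabilityMeasure μ := pinnedChain_isProbabilityMeasure_gibbsMeasure hω hl.le hβ.le γ L hT
  have hV : ∀ r, P.V (-r) = P.V r := pinnedChain_V_neg ω₂ lam β γ
  have hR : MeasurePreserving (siteReflectionEquiv L) μ μ := measurePreserving_siteReflection_gibbsMeasure P hV L T
  have hcons := forwardField_add_comp_siteReflection hω hl hβ hγ hT hL hgC hgL2 hg0 hgeq
  set cH : ℝ := ∫ y, P.hamiltonian L y ∂μ with hcH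
  have hkj2 : MemLp (fun x : PhaseSpace L => x.2 j ^ 2 - T) 2 μ :=
    (pinnedChain_memLp_two_snd_sq hω hl.le hβ.le γ L hT j).sub (memLp_const T)
  have hgRL2 : MemLp (fun x => g (siteReflection L x)) 2 μ := hgL2.comp_measurePreserving hR
  -- reflected pairing: `⟨g∘R, k_j⟩ = ⟨g, k_{rev j}⟩`
  have hrefl : ∫ x, g (siteReflection L x) * (x.2 j ^ 2 - T) ∂μ = ∫ x, g x * (x.2 (Fin.rev j) ^ 2 - T) ∂μ := by
    have h := hR.integral_comp' (f := siteReflectionEquiv L) (fun y => g y * (y.2 (Fin.rev j) ^ 2 - T))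
    simp only [siteReflectionEquiv_apply, siteReflection_snd, Fin.rev_rev] at h
    exact h
  -- pair the conservation law with `k_j`
  have i1 : Integrable (fun x => g x * (x.2 j ^ 2 - T)) μ := hgL2.integrable_mul hkj2
  have i2 : Integrable (fun x => g (siteReflection L x) * (x.2 j ^ 2 - T)) μ := hgRL2.integrable_mul hkj2
  have hHk := integral_hamiltonian_mul_kin hω hl.le hβ.le γ L hT j
  have h0 : ∫ x, (fun _ : PhaseSpace L => (1 : ℝ)) x * (x.2 j ^ 2 - T) ∂μ = 0 :=
    integral_mul_sq_sub_gibbsMeasure_eq_zero hω hl.le hβ.le γ L hT j (F := fun _ => (1 : ℝ)) (fun _ _ => rfl) (memLp_const 1)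
  have h0' : ∫ x, (x.2 j ^ 2 - T) ∂μ = 0 := by
    rw [← h0]; exact integral_congr_ae (ae_of_all _ fun x => by simp only [one_mul])
  have hHs : ContDiff ℝ ∞ (P.hamiltonian L) :=
    P.contDiff_hamiltonian (pinnedChain_contDiff_U ω₂ lam β γ) (pinnedChain_contDiff_V ω₂ lam β γ) L
  have hH0 : ∀ x, 0 ≤ P.hamiltonian L x := fun x => pinnedChain_hamiltonian_nonneg hω.le hl.le hβ.le γ L x
  have hHL2 : MemLp (P.hamiltonian L) 2 μ :=
    pinnedChain_memLp_two_of_abs_le hω hl.le hβ.le γ L hT hHs.continuous (C := 1) (k := 1) fun x => by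
      rw [abs_of_nonneg (hH0 x), pow_one, one_mul]
      linarith [hH0 x]
  have i3 : Integrable (fun x => P.hamiltonian L x * (x.2 j ^ 2 - T)) μ := hHL2.integrable_mul hkj2
  have i4 : Integrable (fun x => (x.2 j ^ 2 - T)) μ := hkj2.integrable one_le_two
  have key : γ * ((∫ x, g x * (x.2 j ^ 2 - T) ∂μ) + ∫ x, g (siteReflection L x) * (x.2 j ^ 2 - T) ∂μ) =
      (∫ x, P.hamiltonian L x * (x.2 j ^ 2 - T) ∂μ) - cH * ∫ x, (x.2 j ^ 2 - T) ∂μ := by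
    rw [← integral_add i1 i2, ← integral_const_mul, ← integral_const_mul, ← integral_sub i3 (i4.const_mul cH)]
    refine integral_congr_ae (ae_of_all _ fun x => ?_)
    dsimp only
    have := hcons x
    calc γ * (g x * (x.2 j ^ 2 - T) + g (siteReflection L x) * (x.2 j ^ 2 - T))
        = (γ * (g x + g (siteReflection L x))) * (x.2 j ^ 2 - T) := by ring
      _ = (P.hamiltonian L x - cH) * (x.2 j ^ 2 - T) := by rw [this]
      _ = P.hamiltonian L x * (x.2 j ^ 2 - T) - cH * (x.2 j ^ 2 - T) := by ring
  rw [hHk, h0', mul_zero, sub_zero, hrefl] at key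
  have hγ0 : γ ≠ 0 := hγ.ne'
  field_simp
  linear_combination key

/-- **SUM RULE `⟨g, Σ_j k_j⟩ = L·T²/(2γ)`**: the left forward field's pairing with (twice) the kinetic-energy fluctuation is
extensive — summing the row sums over all sites and using reflection invariance of the sum. [folklore] -/
theorem integral_forwardField_mul_sum_kin (hω : 0 < ω₂) (hl : 0 < lam) (hβ : 0 < β) (hγ : 0 < γ) (hT : 0 < T)
    {L : ℕ} (hL : 0 < L) {g : PhaseSpace L → ℝ} (hgC : ContDiff ℝ 2 g)
    (hgL2 : MemLp g 2 ((pinnedChain ω₂ lam β γ).gibbsMeasure L T))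
    (hg0 : ∫ x, g x ∂((pinnedChain ω₂ lam β γ).gibbsMeasure L T) = 0)
    (hgeq : ∀ x, (pinnedChain ω₂ lam β γ).generator L T T g x = -(kin L 0 x - T)) :
    ∫ x, g x * (∑ j : Fin L, (x.2 j ^ 2 - T)) ∂((pinnedChain ω₂ lam β γ).gibbsMeasure L T) =
      (L : ℝ) * T ^ 2 / (2 * γ) := by
  set P := pinnedChain ω₂ lam β γ with hP
  set μ := P.gibbsMeasure L T with hμ
  haveI : IsProbabilityMeasure μ := pinnedChain_isProbabilityMeasure_gibbsMeasure hω hl.le hβ.le γ L hT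
  have hkj2 : ∀ j : Fin L, MemLp (fun x : PhaseSpace L => x.2 j ^ 2 - T) 2 μ := fun j =>
    (pinnedChain_memLp_two_snd_sq hω hl.le hβ.le γ L hT j).sub (memLp_const T)
  have hi : ∀ j : Fin L, Integrable (fun x => g x * (x.2 j ^ 2 - T)) μ := fun j => hgL2.integrable_mul (hkj2 j)
  set s : Fin L → ℝ := fun j => ∫ x, g x * (x.2 j ^ 2 - T) ∂μ with hs
  have hsum : ∫ x, g x * (∑ j : Fin L, (x.2 j ^ 2 - T)) ∂μ = ∑ j : Fin L, s j := by
    rw [← integral_finsetSum _ fun j _ => hi j]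
    refine integral_congr_ae (ae_of_all _ fun x => ?_)
    simp only [Finset.mul_sum]
  have hrow : ∀ j : Fin L, s j + s (Fin.rev j) = T ^ 2 / γ := fun j =>
    integral_forwardField_mul_kin_add_rev hω hl hβ hγ hT hL hgC hgL2 hg0 hgeq j
  have hrev : ∑ j : Fin L, s (Fin.rev j) = ∑ j : Fin L, s j :=
    Fintype.sum_equiv Fin.revPerm _ _ fun j => rfl
  have htot : (∑ j : Fin L, s j) + ∑ j : Fin L, s (Fin.rev j) = ∑ _j : Fin L, T ^ 2 / γ := by
    rw [← Finset.sum_add_distrib]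
    exact Finset.sum_congr rfl fun j _ => hrow j
  rw [hrev, Finset.sum_const, Finset.card_univ, Fintype.card_fin, nsmul_eq_mul] at htot
  rw [hsum]
  have hγ0 : γ ≠ 0 := hγ.ne'
  have h2 : ∑ j : Fin L, s j = (L : ℝ) * (T ^ 2 / γ) / 2 := by linarith
  rw [h2]
  field_simp

/-! ## §4 The forward field is extensive in `L²(μ_T)` -/

/-- **`‖g‖²_{L²(μ_T)} ≥ L·T²/(8γ²)`** for every classical mean-zero `C² ∩ L²(μ_T)` left forward field of the `L`-chain (`L ≥ 1`):
Cauchy–Schwarz on the sum rule with `‖Σ_j k_j‖² = 2LT²` (written as `0 ≤ ∫ (g − Σ_j k_j/(4γ))²`). [folklore] -/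
theorem forwardField_sq_norm_ge' (hω : 0 < ω₂) (hl : 0 < lam) (hβ : 0 < β) (hγ : 0 < γ) (hT : 0 < T)
    {L : ℕ} (hL : 0 < L) {g : PhaseSpace L → ℝ} (hgC : ContDiff ℝ 2 g)
    (hgL2 : MemLp g 2 ((pinnedChain ω₂ lam β γ).gibbsMeasure L T))
    (hg0 : ∫ x, g x ∂((pinnedChain ω₂ lam β γ).gibbsMeasure L T) = 0)
    (hgeq : ∀ x, (pinnedChain ω₂ lam β γ).generator L T T g x = -(kin L 0 x - T)) :
    (L : ℝ) * T ^ 2 / (8 * γ ^ 2) ≤ ∫ x, g x ^ 2 ∂((pinnedChain ω₂ lam β γ).gibbsMeasure L T) := by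
  set P := pinnedChain ω₂ lam β γ with hP
  set μ := P.gibbsMeasure L T with hμ
  haveI : IsProbabilityMeasure μ := pinnedChain_isProbabilityMeasure_gibbsMeasure hω hl.le hβ.le γ L hT
  set S : PhaseSpace L → ℝ := fun x => ∑ j : Fin L, (x.2 j ^ 2 - T) with hS
  have hkj2 : ∀ j : Fin L, MemLp (fun x : PhaseSpace L => x.2 j ^ 2 - T) 2 μ := fun j =>
    (pinnedChain_memLp_two_snd_sq hω hl.le hβ.le γ L hT j).sub (memLp_const T)
  have hS2 : MemLp S 2 μ := by
    have := memLp_finsetSum' (Finset.univ : Finset (Fin L)) fun j _ => hkj2 j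
    refine this.ae_eq (ae_of_all _ fun x => ?_)
    simp only [hS, Finset.sum_apply]
  -- `∫ S² = 2 L T²`
  have hSS : ∫ x, S x ^ 2 ∂μ = 2 * (L : ℝ) * T ^ 2 := by
    have hprod : ∀ x, S x ^ 2 = ∑ i : Fin L, ∑ j : Fin L, (x.2 i ^ 2 - T) * (x.2 j ^ 2 - T) := by
      intro x
      simp only [hS, sq, Finset.sum_mul_sum]
    have hij : ∀ i j : Fin L, Integrable (fun x : PhaseSpace L => (x.2 i ^ 2 - T) * (x.2 j ^ 2 - T)) μ :=
      fun i j => (hkj2 i).integrable_mul (hkj2 j)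
    calc ∫ x, S x ^ 2 ∂μ = ∫ x, ∑ i : Fin L, ∑ j : Fin L, (x.2 i ^ 2 - T) * (x.2 j ^ 2 - T) ∂μ :=
          integral_congr_ae (ae_of_all _ fun x => hprod x)
      _ = ∑ i : Fin L, ∫ x, ∑ j : Fin L, (x.2 i ^ 2 - T) * (x.2 j ^ 2 - T) ∂μ :=
          integral_finsetSum _ fun i _ => integrable_finsetSum _ fun j _ => hij i j
      _ = ∑ i : Fin L, ∑ j : Fin L, ∫ x, (x.2 i ^ 2 - T) * (x.2 j ^ 2 - T) ∂μ :=
          Finset.sum_congr rfl fun i _ => integral_finsetSum _ fun j _ => hij i j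
      _ = ∑ i : Fin L, ∑ j : Fin L, (if i = j then 2 * T ^ 2 else 0) :=
          Finset.sum_congr rfl fun i _ => Finset.sum_congr rfl fun j _ => integral_kin_mul_kin hω hl.le hβ.le γ L hT i j
      _ = 2 * (L : ℝ) * T ^ 2 := by
          simp only [Finset.sum_ite_eq, Finset.mem_univ, if_true, Finset.sum_const, Finset.card_univ, Fintype.card_fin,
            nsmul_eq_mul]
          ring
  have hgS : ∫ x, g x * S x ∂μ = (L : ℝ) * T ^ 2 / (2 * γ) :=
    integral_forwardField_mul_sum_kin hω hl hβ hγ hT hL hgC hgL2 hg0 hgeq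
  -- `0 ≤ ∫ (g − S/(4γ))²`
  have igg : Integrable (fun x => g x ^ 2) μ := hgL2.integrable_sq
  have igS : Integrable (fun x => g x * S x) μ := hgL2.integrable_mul hS2
  have iSS : Integrable (fun x => S x ^ 2) μ := hS2.integrable_sq
  have hnn : 0 ≤ ∫ x, (g x - S x / (4 * γ)) ^ 2 ∂μ := integral_nonneg fun x => sq_nonneg _
  have hexp : ∫ x, (g x - S x / (4 * γ)) ^ 2 ∂μ =
      (∫ x, g x ^ 2 ∂μ) - (1 / (2 * γ)) * (∫ x, g x * S x ∂μ) + (1 / (16 * γ ^ 2)) * ∫ x, S x ^ 2 ∂μ := by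
    have i2 : Integrable (fun x => (1 / (2 * γ)) * (g x * S x)) μ := igS.const_mul _
    have i3 : Integrable (fun x => (1 / (16 * γ ^ 2)) * S x ^ 2) μ := iSS.const_mul _
    have i12 : Integrable (fun x => g x ^ 2 - (1 / (2 * γ)) * (g x * S x)) μ := igg.sub i2
    rw [← integral_const_mul, ← integral_const_mul, ← integral_sub igg i2, ← integral_add i12 i3]
    refine integral_congr_ae (ae_of_all _ fun x => ?_)
    have hγ0 : γ ≠ 0 := hγ.ne'
    field_simp
    ring
  rw [hexp, hgS, hSS] at hnn
  have hγ0 : γ ≠ 0 := hγ.ne'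
  have h1 : (1 / (2 * γ)) * ((L : ℝ) * T ^ 2 / (2 * γ)) = (L : ℝ) * T ^ 2 / (4 * γ ^ 2) := by field_simp; ring
  have h2 : (1 / (16 * γ ^ 2)) * (2 * (L : ℝ) * T ^ 2) = (L : ℝ) * T ^ 2 / (8 * γ ^ 2) := by field_simp; ring
  rw [h1, h2] at hnn
  have h3 : (L : ℝ) * T ^ 2 / (4 * γ ^ 2) = 2 * ((L : ℝ) * T ^ 2 / (8 * γ ^ 2)) := by field_simp; ring
  linarith

/-- **`‖g‖²_{L²(μ_T)} ≥ L·T²/(8γ²)`** (registered helper `forwardField_sq_norm_ge`, verbatim signature): the left forward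
fields of the `L`-chains diverge in `L²(μ_T)` like `√L`. [folklore] -/
theorem forwardField_sq_norm_ge : ∀ {ω₂ lam β γ T : ℝ}, 0 < ω₂ → 0 < lam → 0 < β → 0 < γ → 0 < T → ∀ {L : ℕ}, 0 < L → ∀ {g : PhaseSpace L → ℝ}, ContDiff ℝ 2 g → MemLp g 2 ((pinnedChain ω₂ lam β γ).gibbsMeasure L T) → ∫ x, g x ∂((pinnedChain ω₂ lam β γ).gibbsMeasure L T) = 0 → (∀ x, (pinnedChain ω₂ lam β γ).generator L T T g x = -(kin L 0 x - T)) → (L : ℝ) * T ^ 2 / (8 * γ ^ 2) ≤ ∫ x, g x ^ 2 ∂((pinnedChain ω₂ lam β γ).gibbsMeasure L T) :=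
  fun hω hl hβ hγ hT _ hL _ hgC hgL2 hg0 hgeq => forwardField_sq_norm_ge' hω hl hβ hγ hT hL hgC hgL2 hg0 hgeq

end Summit.AtomisticToContinuum.FouriersLaw.Cruxes.ConductanceLowerBound.ForecastSensitivity

end
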